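import Literature.NumberTheory.DiophantineGeometry.PlaneCurveRationalPointProofs
import Literature.NumberTheory.DiophantineGeometry.FunctionFieldRationalPlaceBoundsProofs
import Literature.NumberTheory.DiophantineGeometry.FunctionFieldDedekindKummer
import Literature.NumberTheory.DiophantineGeometry.RatFuncPlaces
import Literature.NumberTheory.DiophantineGeometry.PlaneCurveSeparableFibersProofs
import HarnessLib

/-!
# Weil's estimate for the number of points of a (possibly singular) plane curve

For a finite field `K = 𝔽_q` and `Φ ∈ K[X][Y]` monic of degree `d` in `Y`, of total degree `d`,
absolutely irreducible and separable over `K(X)`, the number `N(Φ) = #{(a, b) ∈ K² : Φ(a, b) = 0}`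
of `K`-rational points of the affine plane curve `Φ = 0` satisfies

  `|N(Φ) - (q + 1)| ≤ (d-1)(d-2) √q + d (1 + d(d-1))`   (`abs_card_zeros_sub_le`),

the two-sided form of "Weil's estimate (1.2)" for singular plane curves used (through Schmidt's
Lemma 5 = Cafure–Matera's Lemma 5.1) in the proof of Cafure–Matera's Thm. 5.2, with the term
`δ + 1` of the printed `ω(q, δ) = (δ-1)(δ-2)q^{1/2} + δ + 1` replaced by the cruder
`d(1 + d(d-1))` (the difference is absorbed by the slack of (22) in the proof of Thm. 5.2).

## Proof (fibrewise, through Kummer's theorem; no theory of singular points)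

Let `F = K(x)[y]/(Φ)` be the function field of the curve (`PlaneCurveFunctionFieldProofs`), with
full constant field `K` (`PlaneCurveConstantFieldProofs`), genus `g`, `2g ≤ (d-1)(d-2)`
(`PlaneCurveGenusBoundProofs`) and `N₁` rational places, `|N₁ - (q+1)| ≤ 2g√q` (Hasse–Weil,
`hasseWeil_holds`, two-sided form from `FunctionFieldRationalPlaceBoundsProofs`). The rational places
split into the poles of `x` (at most `deg (x)_∞ = d` of them) and, for each `a ∈ K`, the places
`P` with `x ≡ a (mod P)` (`card_ratPlaces_eq_card_poles_add_sum`); there are at most `d` of the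
latter for each `a` (they are poles of `1/(x-a)`, `card_filter_valuation_sub_lt_one_le`), and when
the fibre polynomial `Φ(a, Y) ∈ K[Y]` is separable **Kummer's theorem**
(`FunctionFieldDedekindKummer`) at the place `P_a` of `K(x)` shows that they correspond to the
linear factors of `Φ(a, Y)`, i.e. to the rational points `(a, b)` of the curve
(`card_filter_valuation_sub_lt_one_eq`). Since at most `d(d-1)` fibres are inseparable
(`PlaneCurveSeparableFibersProofs`) and every fibre has at most `d` points,
`|N(Φ) - N₁| ≤ d + d · d(d-1)`.

No definitions, no new named facts.

## References

* A. Cafure, G. Matera, *Improved explicit estimates on the number of solutions of equations over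
  a finite field*, Finite Fields Appl. 12 (2006) 155–185, §1 eq. (1.2) and Lemma 5.1.
  [CafureMatera2006]
* H. Stichtenoth, *Algebraic Function Fields and Codes*, 2nd ed., GTM 254, Springer 2009,
  Thm. 3.3.7 (Kummer), Thm. 5.2.3 (Hasse–Weil bound). [Stichtenoth2009]
-/

noncomputable section

open scoped Classical Polynomial.Bivariate IntermediateField
open Polynomial

namespace Literature.NumberTheory.DiophantineGeometry.AlgFunctionField

universe u v

/-! ### Generalities on rational places of a function field over a finite field -/

section General

variable {K : Type u} {F : Type v} [Field K] [Field F] [Algebra K F]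

namespace PlaceOver

/-- `v_P(z - c) < 1` forces `z ∈ O_P` (`c ∈ K`). [folklore] -/
theorem mem_of_valuation_sub_algebraMap_lt_one (P : PlaceOver K F) {z : F} {c : K}
    (h : P.valuation (z - algebraMap K F c) < 1) : z ∈ P.toValuationSubring := by
  have h1 : z - algebraMap K F c ∈ P.toValuationSubring :=
    (P.toValuationSubring.valuation_le_one_iff _).1 h.le
  have h2 : z = (z - algebraMap K F c) + algebraMap K F c := by ring
  rw [h2]
  exact add_mem h1 (P.algebraMap_mem c)

/-- The residue class `z ≡ c (mod P)` of `z ∈ O_P` is unique: `v_P(z - c) < 1` and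
`v_P(z - c') < 1` force `c = c'`. [folklore] -/
theorem eq_of_valuation_sub_algebraMap_lt_one (P : PlaceOver K F) {z : F} {c c' : K}
    (h : P.valuation (z - algebraMap K F c) < 1) (h' : P.valuation (z - algebraMap K F c') < 1) :
    c = c' := by
  by_contra hne
  have h1 : P.valuation ((z - algebraMap K F c') - (z - algebraMap K F c)) < 1 :=
    lt_of_le_of_lt (Valuation.map_sub _ _ _) (max_lt h' h)
  rw [sub_sub_sub_cancel_left, ← map_sub,
    P.valuation_algebraMap_eq_one (sub_ne_zero.2 hne)] at h1
  exact lt_irrefl _ h1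

/-- At a rational place every `z ∈ O_P` is congruent to a constant: `v_P(z - c) < 1` for some
`c ∈ K`. [folklore] -/
theorem exists_valuation_sub_algebraMap_lt_one_of_degree_eq_one (P : PlaceOver K F)
    (hP : P.degree = 1) {z : F}
    (hz : z ∈ P.toValuationSubring) : ∃ c : K, P.valuation (z - algebraMap K F c) < 1 := by
  obtain ⟨c, hc⟩ := P.algebraMap_residueField_surjective_of_degree_eq_one hP
    (IsLocalRing.residue P.toValuationSubring ⟨z, hz⟩)
  refine ⟨c, ?_⟩
  rw [P.algebraMap_residueField_apply] at hc
  have := (residue_eq_residue_iff P (F' := F) ⟨z, hz⟩ (algebraMap K P.toValuationSubring c)).1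
    hc.symm
  simpa using this

end PlaceOver

variable [Fintype K] [IsAlgFunctionField K F]

/-- **Rational places sorted by the residue of `x`.** The rational places of `F/K` are the poles
of `x` together with, for each `a ∈ K`, the places `P` with `x ≡ a (mod P)`:
`N₁ = #{P : x ∉ O_P} + ∑_{a ∈ K} #{P : v_P(x - a) < 1}` (rational places only). [folklore] -/
theorem card_ratPlaces_eq_card_poles_add_sum (x : F) :
    (finite_setOf_degree_eq (K := K) (F := F) 1).toFinset.card =
      ((finite_setOf_degree_eq (K := K) (F := F) 1).toFinset.filter
          fun P ↦ x ∉ P.toValuationSubring).card +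
        ∑ a : K, ((finite_setOf_degree_eq (K := K) (F := F) 1).toFinset.filter
          fun P ↦ P.valuation (x - algebraMap K F a) < 1).card := by
  set S := (finite_setOf_degree_eq (K := K) (F := F) 1).toFinset with hS
  have hmemS : ∀ P, P ∈ S ↔ P.degree = 1 := fun P ↦ by
    rw [hS, Set.Finite.mem_toFinset, Set.mem_setOf_eq]
  rw [← Finset.card_filter_add_card_filter_not (p := fun P ↦ x ∉ P.toValuationSubring)]
  congr 1
  have hunion : S.filter (fun P ↦ ¬ x ∉ P.toValuationSubring) =
      (Finset.univ : Finset K).biUnion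
        fun a ↦ S.filter fun P ↦ P.valuation (x - algebraMap K F a) < 1 := by
    ext P
    simp only [Finset.mem_filter, not_not, Finset.mem_biUnion, Finset.mem_univ, true_and]
    constructor
    · rintro ⟨hPS, hx⟩
      obtain ⟨c, hc⟩ := P.exists_valuation_sub_algebraMap_lt_one_of_degree_eq_one ((hmemS P).1 hPS) hx
      exact ⟨c, hPS, hc⟩
    · rintro ⟨c, hPS, hc⟩
      exact ⟨hPS, P.mem_of_valuation_sub_algebraMap_lt_one hc⟩
  rw [hunion, Finset.card_biUnion]
  intro a _ b _ hab
  rw [Function.onFun, Finset.disjoint_left]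
  intro P ha hb
  rw [Finset.mem_filter] at ha hb
  exact hab (P.eq_of_valuation_sub_algebraMap_lt_one ha.2 hb.2)

/-- **At most `[F : K(x)]` rational poles of `x`.** [cite: Stichtenoth2009, Thm. 1.4.11] -/
theorem card_filter_not_mem_le {x : F} (hx : Transcendental K x) :
    ((finite_setOf_degree_eq (K := K) (F := F) 1).toFinset.filter
        fun P ↦ x ∉ P.toValuationSubring).card ≤ Module.finrank K⟮x⟯ F := by
  have hx0 : x ≠ 0 := fun h ↦ hx (h ▸ isAlgebraic_zero)
  set S := (finite_setOf_degree_eq (K := K) (F := F) 1).toFinset with hS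
  have hsub : S.filter (fun P ↦ x ∉ P.toValuationSubring) ⊆ ((principalDivisor K x)⁻).support :=
    fun P hP ↦ mem_support_negPart_principalDivisor hx0 (Finset.mem_filter.1 hP).2
  have h1 : ((S.filter fun P ↦ x ∉ P.toValuationSubring).card : ℤ) ≤ Module.finrank K⟮x⟯ F := by
    rw [← degree_negPart_principalDivisor_eq hx]
    exact (Nat.cast_le.2 (Finset.card_le_card hsub)).trans
      (card_support_le_degree (negPart_nonneg _))
  exact_mod_cast h1

omit [Fintype K] [IsAlgFunctionField K F] in
/-- Equal intermediate fields have the same codegree in `F`. [folklore] -/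
theorem finrank_eq_of_eq {E₁ E₂ : IntermediateField K F} (h : E₁ = E₂) :
    Module.finrank E₁ F = Module.finrank E₂ F := by
  subst h
  rfl

/-- **At most `[F : K(x)]` rational places with `x ≡ a`.** The rational places `P` with
`v_P(x - a) < 1` are poles of `z = 1/(x - a)`, and `deg (z)_∞ = [F : K(z)] = [F : K(x)]`.
[cite: Stichtenoth2009, Thm. 1.4.11] -/
theorem card_filter_valuation_sub_lt_one_le {x : F} (hx : Transcendental K x) (a : K) :
    ((finite_setOf_degree_eq (K := K) (F := F) 1).toFinset.filter
        fun P ↦ P.valuation (x - algebraMap K F a) < 1).card ≤ Module.finrank K⟮x⟯ F := by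
  set S := (finite_setOf_degree_eq (K := K) (F := F) 1).toFinset with hS
  set w : F := x - algebraMap K F a with hw
  have hw0 : w ≠ 0 := by
    intro h0
    apply hx
    have : x = algebraMap K F a := sub_eq_zero.1 h0
    rw [this]
    exact isAlgebraic_algebraMap a
  set z : F := w⁻¹ with hz
  have hz0 : z ≠ 0 := inv_ne_zero hw0
  have hzt : Transcendental K z := by
    intro halg
    apply hx
    have h1 : IsAlgebraic K w := by
      have := halg.inv
      rwa [hz, inv_inv] at this
    have h2 : x = w + algebraMap K F a := by rw [hw]; ring
    rw [h2]
    exact h1.add (isAlgebraic_algebraMap a)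
  have hsub : S.filter (fun P ↦ P.valuation w < 1) ⊆ ((principalDivisor K z)⁻).support := by
    intro P hP
    refine mem_support_negPart_principalDivisor hz0 fun hzP ↦ ?_
    have hlt := (Finset.mem_filter.1 hP).2
    have h1 : 1 < P.valuation z := by
      rw [hz, Valuation.one_lt_val_iff _ (inv_ne_zero hw0), inv_inv]
      exact hlt
    have h2 : P.valuation z ≤ 1 := (P.toValuationSubring.valuation_le_one_iff z).2 hzP
    exact not_lt.2 h2 h1
  have h1 : ((S.filter fun P ↦ P.valuation w < 1).card : ℤ) ≤ Module.finrank K⟮z⟯ F := by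
    rw [← degree_negPart_principalDivisor_eq hzt]
    exact (Nat.cast_le.2 (Finset.card_le_card hsub)).trans
      (card_support_le_degree (negPart_nonneg _))
  have h2 : Module.finrank K⟮z⟯ F = Module.finrank K⟮x⟯ F :=
    finrank_eq_of_eq (adjoin_inv_sub_algebraMap_eq x a)
  rw [h2] at h1
  exact_mod_cast h1

end General

/-! ### Rational places over `P_a` and the roots of `Φ(a, Y)` (Kummer's theorem) -/

section Model

variable {K : Type u} [Field K]
variable {F : Type u} [Field F] [Algebra K F] [Algebra K[X] F] [Algebra (RatFunc K) F]
  [IsScalarTower K[X] (RatFunc K) F] [IsScalarTower K (RatFunc K) F] [IsScalarTower K K[X] F]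

omit [IsScalarTower K K[X] F] in
/-- `(X - a) ∈ K(X)` maps to `x - a ∈ F`. [folklore] -/
theorem algebraMap_ratFunc_X_sub_C (a : K) :
    algebraMap (RatFunc K) F (RatFunc.X - RatFunc.C a) = algebraMap K[X] F X - algebraMap K F a := by
  rw [map_sub, algebraMap_ratFunc_X, ← RatFunc.algebraMap_eq_C, ← IsScalarTower.algebraMap_apply]

variable [Fintype K] [IsAlgFunctionField K F] [FiniteDimensional (RatFunc K) F]

omit [Fintype K] [IsAlgFunctionField K F] in
/-- **The place below a rational place with `x ≡ a` is `P_a`.** If `v_P(x - a) < 1` then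
`P ∩ K(x) = P_{x-a}` (Stichtenoth Thm. 1.2.2: it is a place of `K(x)` containing `x`, hence some
`P_{p(x)}`, and `p = x - a` since `x - a` is not a unit). [cite: Stichtenoth2009, Thm. 1.2.2] -/
theorem restrict_eq_placeXSubC_of_valuation_lt_one {P : PlaceOver K F} {a : K}
    (h : P.valuation (algebraMap K[X] F X - algebraMap K F a) < 1) :
    P.restrict (K := K) (F := RatFunc K) = placeXSubC a := by
  set x : F := algebraMap K[X] F X with hx
  have hxt : Transcendental K x := transcendental_algebraMap_X K F
  have hw0 : x - algebraMap K F a ≠ 0 := by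
    intro h0
    apply hxt
    rw [sub_eq_zero.1 h0]
    exact isAlgebraic_algebraMap a
  have hxP : x ∈ P.toValuationSubring := P.mem_of_valuation_sub_algebraMap_lt_one h
  set Q := P.restrict (K := K) (F := RatFunc K) with hQ
  rcases eq_ratFuncInftyPlace_or_exists_eq_ofPrime Q with hinf | ⟨q, hq⟩
  · -- `x ∈ O_P` rules out the infinite place
    exfalso
    have h1 : RatFunc.X ∈ Q.toValuationSubring := by
      rw [hQ, PlaceOver.mem_restrict_iff, algebraMap_ratFunc_X]
      exact hxP
    rw [hinf, mem_ratFuncInftyPlace_iff, RatFunc.inftyValuation.X, ← WithZero.exp_zero,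
      WithZero.exp_le_exp] at h1
    exact absurd h1 (by norm_num)
  · -- `Q = P_q` with `X - a ∈ q`, so `q = (X - a)`
    have hmem : (X - C a : K[X]) ∈ q.asIdeal := by
      rw [← IsDedekindDomain.HeightOneSpectrum.valuation_lt_one_iff_mem (K := RatFunc K)]
      by_contra hge
      rw [not_lt] at hge
      have hle : q.valuation (RatFunc K) (algebraMap K[X] (RatFunc K) (X - C a)) ≤ 1 :=
        IsDedekindDomain.HeightOneSpectrum.valuation_le_one q _
      have heq : q.valuation (RatFunc K) (algebraMap K[X] (RatFunc K) (X - C a)) = 1 :=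
        le_antisymm hle hge
      -- then `(X - a)⁻¹ ∈ O_Q`, i.e. `(x - a)⁻¹ ∈ O_P`, contradicting `v_P(x - a) < 1`
      have hinvQ : (algebraMap K[X] (RatFunc K) (X - C a))⁻¹ ∈ Q.toValuationSubring := by
        rw [hq, PlaceOver.mem_ofPrime_iff, map_inv₀, heq, inv_one]
      rw [hQ, PlaceOver.mem_restrict_iff, map_inv₀, map_sub, RatFunc.algebraMap_X,
        RatFunc.algebraMap_C, algebraMap_ratFunc_X_sub_C] at hinvQ
      have h1 : P.valuation (x - algebraMap K F a)⁻¹ ≤ 1 :=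
        (P.toValuationSubring.valuation_le_one_iff _).2 hinvQ
      have h2 : 1 < P.valuation (x - algebraMap K F a)⁻¹ := by
        rw [Valuation.one_lt_val_iff _ (inv_ne_zero hw0), inv_inv]
        exact h
      exact not_lt.2 h1 h2
    have hqeq : q = idealXSubC a := by
      have hmax : (idealXSubC a).asIdeal.IsMaximal := by
        rw [idealXSubC_asIdeal]
        exact PrincipalIdealRing.isMaximal_of_irreducible (irreducible_X_sub_C a)
      have hle : (idealXSubC a).asIdeal ≤ q.asIdeal := by
        rw [idealXSubC_asIdeal, Ideal.span_le, Set.singleton_subset_iff]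
        exact hmem
      have := (hmax.eq_of_le q.isPrime.ne_top hle).symm
      exact IsDedekindDomain.HeightOneSpectrum.ext this
    rw [hq, hqeq]
    rfl

omit [Fintype K] [IsAlgFunctionField K F] in
/-- **A place above `P_a` has `x ≡ a`.** If `P ∩ K(x) = P_{x-a}` then `v_P(x - a) < 1`
(`1/(x-a) ∉ O_{P_a}`). [folklore] -/
theorem valuation_lt_one_of_restrict_eq_placeXSubC {P : PlaceOver K F} {a : K}
    (h : P.restrict (K := K) (F := RatFunc K) = placeXSubC a) :
    P.valuation (algebraMap K[X] F X - algebraMap K F a) < 1 := by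
  set x : F := algebraMap K[X] F X with hx
  have hxt : Transcendental K x := transcendental_algebraMap_X K F
  have hw0 : x - algebraMap K F a ≠ 0 := by
    intro h0
    apply hxt
    rw [sub_eq_zero.1 h0]
    exact isAlgebraic_algebraMap a
  have hBP := PlaceOver.forall_mem_iff_of_restrict_eq h
  have h1 : (x - algebraMap K F a)⁻¹ ∉ P.toValuationSubring := by
    intro hmem
    rw [← algebraMap_ratFunc_X_sub_C, ← map_inv₀, hBP] at hmem
    exact inv_X_sub_C_notMem_placeXSubC a hmem
  rw [← (P.toValuationSubring.valuation_le_one_iff _).not, not_le] at h1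
  rwa [Valuation.one_lt_val_iff _ (inv_ne_zero hw0), inv_inv] at h1

variable [Algebra.IsSeparable (RatFunc K) F]

/-- **Rational places with `x ≡ a` versus roots of `Φ(a, Y)` (Kummer's theorem).** Let `F/K(x)`
be finite separable, generated by `y` with minimal polynomial `Φ ∈ K[X][Y]` (monic in `Y`,
`[F : K(x)] = deg_Y Φ`), `K` finite. If the fibre polynomial `Φ(a, Y) ∈ K[Y]` is separable, then
the rational places `P` of `F/K` with `x ≡ a (mod P)` are in bijection with the roots `b ∈ K` of
`Φ(a, Y)`, i.e. with the rational points `(a, b)` of the curve `Φ = 0`: by Kummer's theorem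
(Stichtenoth Thm. 3.3.7) at the rational place `P_a` of `K(x)`, whose residue field is `K` and
modulo which `Φ` reduces to `Φ(a, Y)`, the places above `P_a` correspond to the monic irreducible
factors `γ` of `Φ(a, Y)`, with `deg P_γ = deg γ`. [cite: Stichtenoth2009, Thm. 3.3.7] -/
theorem card_filter_valuation_sub_lt_one_eq {Φ : K[X][Y]} (hm : Φ.Monic) {y : F}
    (hmin : minpoly (RatFunc K) y = Φ.map (algebraMap K[X] (RatFunc K)))
    (hfin : Module.finrank (RatFunc K) F = Φ.natDegree)
    (a : K) (hsep : (Φ.map (evalRingHom a)).Separable) :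
    ((finite_setOf_degree_eq (K := K) (F := F) 1).toFinset.filter
        fun P ↦ P.valuation (algebraMap K[X] F X - algebraMap K F a) < 1).card =
      (Finset.univ.filter fun b : K ↦ Φ.evalEval a b = 0).card := by
  set L := RatFunc K with hL
  set x : F := algebraMap K[X] F X with hx
  set S := (finite_setOf_degree_eq (K := K) (F := F) 1).toFinset with hS
  have hmemS : ∀ P, P ∈ S ↔ P.degree = 1 := fun P ↦ by
    rw [hS, Set.Finite.mem_toFinset, Set.mem_setOf_eq]
  -- the rational place `P_a` of `K(x)` and its residue field `K`
  set P₀ : PlaceOver K L := placeXSubC a with hP₀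
  have hP₀deg : P₀.degree = 1 := isRational_placeXSubC a
  set O := P₀.toValuationSubring with hO
  set ι : K →+* P₀.residueField := algebraMap K P₀.residueField with hι
  have hιinj : Function.Injective ι := ι.injective
  have hιsurj : Function.Surjective ι := P₀.algebraMap_residueField_surjective_of_degree_eq_one hP₀deg
  -- `Φ` with coefficients in `O = O_{P_a} ⊇ K[X]`
  set ιO : K[X] →+* O := (algebraMap K[X] L).codRestrict O
    (fun p ↦ PlaceOver.algebraMap_mem_ofPrime (K := K) (F := L) (idealXSubC a) p) with hιO
  have hιO_coe : ∀ p : K[X], ((ιO p : O) : L) = algebraMap K[X] L p := fun p ↦ rfl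
  set φ : O[X] := Φ.map ιO with hφ
  have hφm : φ.Monic := hm.map ιO
  have hφmap : φ.map (algebraMap O L) = Φ.map (algebraMap K[X] L) := by
    rw [hφ, Polynomial.map_map]
    congr 1
  have hmin' : minpoly L y = φ.map (algebraMap O L) := by rw [hφmap]; exact hmin
  have hdeg' : Module.finrank L F = φ.natDegree := by rw [hfin, hφ, hm.natDegree_map]
  -- the reduction of `φ` modulo `P_a` is `Φ(a, Y)` read in `F_{P_a} = K`
  set ψ : (P₀.residueField)[X] := (Φ.map (evalRingHom a)).map ι with hψ
  have hψsep : ψ.Separable := hsep.map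
  have hψm : ψ.Monic := (hm.map _).map _
  have hψ0 : ψ ≠ 0 := hψm.ne_zero
  have hred : φ.map (IsLocalRing.residue O) = ψ := by
    rw [hφ, hψ, Polynomial.map_map, Polynomial.map_map]
    congr 1
    refine Polynomial.ringHom_ext (fun c ↦ ?_) ?_
    · rw [RingHom.comp_apply, RingHom.comp_apply, coe_evalRingHom, eval_C]
      have h1 : ιO (C c) = algebraMap K O c := by
        apply Subtype.ext
        rw [hιO_coe, PlaceOver.algebraMap_toValuationSubring_apply,
          IsScalarTower.algebraMap_apply K K[X] L, Polynomial.algebraMap_eq]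
      rw [h1, hι, PlaceOver.algebraMap_residueField_apply]
    · rw [RingHom.comp_apply, RingHom.comp_apply, coe_evalRingHom, eval_X]
      have h1 : ι a = IsLocalRing.residue O (algebraMap K O a) := by
        rw [hι, PlaceOver.algebraMap_residueField_apply]
      rw [h1]
      apply Ideal.Quotient.eq.2
      rw [(P₀.mem_maximalIdeal_iff_of_mem_iff (v := (idealXSubC a).valuation L)
        (fun z ↦ mem_placeXSubC_iff a z))]
      change (idealXSubC a).valuation L ((ιO X : L) - (algebraMap K O a : L)) < 1
      rw [hιO_coe, PlaceOver.algebraMap_toValuationSubring_apply, RatFunc.algebraMap_X,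
        RatFunc.algebraMap_eq_C, valuation_idealXSubC_X_sub_C, ← WithZero.exp_zero,
        WithZero.exp_lt_exp]
      norm_num
  -- the factorisation of the (separable) reduction into distinct monic irreducibles
  set Sfac := (UniqueFactorizationMonoid.normalizedFactors ψ).toFinset with hSfac
  have hmemSfac : ∀ γ ∈ Sfac, γ ∈ UniqueFactorizationMonoid.normalizedFactors ψ := fun γ hγ ↦
    Multiset.mem_toFinset.1 hγ
  have hirr : ∀ γ ∈ Sfac, Irreducible γ := fun γ hγ ↦
    UniqueFactorizationMonoid.irreducible_of_normalized_factor γ (hmemSfac γ hγ)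
  have hmon : ∀ γ ∈ Sfac, γ.Monic := fun γ hγ ↦ by
    rw [← UniqueFactorizationMonoid.normalize_normalized_factor γ (hmemSfac γ hγ)]
    exact Polynomial.monic_normalize (hirr γ hγ).ne_zero
  have hnodup : (UniqueFactorizationMonoid.normalizedFactors ψ).Nodup :=
    (UniqueFactorizationMonoid.squarefree_iff_nodup_normalizedFactors hψ0).1 hψsep.squarefree
  have hprod : ∏ γ ∈ Sfac, γ = φ.map (IsLocalRing.residue O) := by
    rw [hred]
    have hSm : (∏ γ ∈ Sfac, γ).Monic := monic_prod_of_monic _ _ fun γ hγ ↦ hmon γ hγ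
    have h1 : ∏ γ ∈ Sfac, γ = (UniqueFactorizationMonoid.normalizedFactors ψ).prod := by
      rw [Finset.prod_eq_multiset_prod, hSfac, Multiset.toFinset_val, hnodup.dedup,
        Multiset.map_id']
    rw [h1] at hSm ⊢
    exact Polynomial.eq_of_monic_of_associated hSm hψm
      (UniqueFactorizationMonoid.prod_normalizedFactors hψ0)
  -- Kummer's theorem at `P_a`
  obtain ⟨Ψ, hinj, hall, hspec⟩ := P₀.exists_placesOver_of_prod_eq hφm hmin' hdeg' Sfac hirr hmon
    hprod
  -- the rational places with `x ≡ a` are the `Ψ γ`, `γ ∈ Sfac` linear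
  set T := S.filter fun P ↦ P.valuation (x - algebraMap K F a) < 1 with hT
  set T' := Sfac.filter fun γ ↦ γ.natDegree = 1 with hT'
  have hTeq : T = T'.image Ψ := by
    ext P
    simp only [hT, hT', Finset.mem_filter, Finset.mem_image, hmemS]
    constructor
    · rintro ⟨hPdeg, hPval⟩
      have hres : P.restrict (K := K) (F := L) = P₀ :=
        restrict_eq_placeXSubC_of_valuation_lt_one hPval
      obtain ⟨γ, hγ, rfl⟩ := hall P hres
      refine ⟨γ, ⟨hγ, ?_⟩, rfl⟩
      have h := (hspec γ hγ).2.2.2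
      rw [hPdeg, hP₀deg, mul_one] at h
      exact h.symm
    · rintro ⟨γ, ⟨hγ, hγ1⟩, rfl⟩
      obtain ⟨hres, -, -, hdegγ⟩ := hspec γ hγ
      refine ⟨by rw [hdegγ, hγ1, hP₀deg], ?_⟩
      exact valuation_lt_one_of_restrict_eq_placeXSubC hres
  have hcardT : T.card = T'.card := by
    rw [hTeq]
    exact Finset.card_image_of_injOn (hinj.mono (Finset.filter_subset _ _))
  -- the linear factors of `ψ` are the `X - b`, `b ∈ K` a root of `Φ(a, Y)`
  set Tb := (Finset.univ : Finset K).filter fun b ↦ Φ.evalEval a b = 0 with hTb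
  set e : K → (P₀.residueField)[X] := fun b ↦ X - C (ι b) with he
  have heinj : Function.Injective e := fun b b' h ↦
    hιinj (C_injective (sub_right_injective h))
  have hroot : ∀ b : K, ψ.IsRoot (ι b) ↔ Φ.evalEval a b = 0 := fun b ↦ by
    rw [IsRoot.def, hψ, eval_map, eval₂_hom, map_evalRingHom_eval,
      _root_.map_eq_zero_iff _ hιinj]
  have hTbeq : T' = Tb.image e := by
    ext γ
    simp only [hT', hTb, Finset.mem_filter, Finset.mem_image, Finset.mem_univ, true_and, he]
    constructor
    · rintro ⟨hγ, hγ1⟩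
      have hγm := hmon γ hγ
      have hγeq : γ = X + C (γ.coeff 0) := hγm.eq_X_add_C hγ1
      obtain ⟨b, hb⟩ := hιsurj (-γ.coeff 0)
      refine ⟨b, ?_, ?_⟩
      · rw [← hroot, ← dvd_iff_isRoot]
        have : (X - C (ι b)) = γ := by rw [hb, map_neg, sub_neg_eq_add, ← hγeq]
        rw [this]
        exact UniqueFactorizationMonoid.dvd_of_mem_normalizedFactors (hmemSfac γ hγ)
      · rw [hb, map_neg, sub_neg_eq_add, ← hγeq]
    · rintro ⟨b, hb, rfl⟩
      have hdvd : (X - C (ι b)) ∣ ψ := dvd_iff_isRoot.2 ((hroot b).2 hb)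
      obtain ⟨γ', hγ', hassoc⟩ :=
        UniqueFactorizationMonoid.exists_mem_normalizedFactors_of_dvd hψ0
          (irreducible_X_sub_C (ι b)) hdvd
      have hγ'mem : γ' ∈ Sfac := Multiset.mem_toFinset.2 hγ'
      have heq : X - C (ι b) = γ' :=
        eq_of_monic_of_associated (monic_X_sub_C _) (hmon γ' hγ'mem) hassoc
      refine ⟨heq ▸ hγ'mem, natDegree_X_sub_C _⟩
  rw [hcardT, hTbeq, Finset.card_image_of_injective _ heinj]

/-- **Rational points versus rational places of a plane model.** In the situation of
`card_filter_valuation_sub_lt_one_eq` (with `Φ` moreover of total degree `d = deg_Y Φ` and separable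
over `K(x)`), the number `N = #{(a, b) ∈ K² : Φ(a, b) = 0}` of rational points and the number `N₁`
of rational places of `F/K` satisfy `N ≤ N₁ + d · d(d-1)` and `N₁ ≤ N + d + d · d(d-1)`:
sort the rational places by the residue of `x` (`card_ratPlaces_eq_card_poles_add_sum`), compare
with the fibres of `Φ = 0` over the separable fibres (Kummer), and bound the at most `d(d-1)`
inseparable fibres (`card_filter_not_separable_le`) and the poles of `x` by `d` each. [folklore] -/
theorem card_zeros_le_card_ratPlaces_add {Φ : K[X][Y]} (hm : Φ.Monic)
    (hdeg : ∀ i, i < Φ.natDegree → (Φ.coeff i).natDegree + i ≤ Φ.natDegree) {y : F}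
    (hmin : minpoly (RatFunc K) y = Φ.map (algebraMap K[X] (RatFunc K)))
    (hfin : Module.finrank (RatFunc K) F = Φ.natDegree)
    (hsep : (Φ.map (algebraMap K[X] (RatFunc K))).Separable) :
    (Finset.univ.filter fun p : K × K ↦ Φ.evalEval p.1 p.2 = 0).card ≤
        (finite_setOf_degree_eq (K := K) (F := F) 1).toFinset.card +
          Φ.natDegree * (Φ.natDegree * (Φ.natDegree - 1)) ∧
      (finite_setOf_degree_eq (K := K) (F := F) 1).toFinset.card ≤
        (Finset.univ.filter fun p : K × K ↦ Φ.evalEval p.1 p.2 = 0).card + Φ.natDegree +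
          Φ.natDegree * (Φ.natDegree * (Φ.natDegree - 1)) := by
  set x : F := algebraMap K[X] F X with hx
  have hxt : Transcendental K x := transcendental_algebraMap_X K F
  have hfinx : Module.finrank K⟮x⟯ F = Φ.natDegree := by
    rw [hx, finrank_adjoin_algebraMap_X K F, hfin]
  -- notation for the counts
  set d := Φ.natDegree with hd
  set S := (finite_setOf_degree_eq (K := K) (F := F) 1).toFinset with hS
  set p := (S.filter fun P ↦ x ∉ P.toValuationSubring).card with hp
  set r : K → ℕ := fun a ↦ (S.filter fun P ↦ P.valuation (x - algebraMap K F a) < 1).card with hr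
  set t : K → ℕ := fun a ↦ ((Finset.univ : Finset K).filter fun b ↦ Φ.evalEval a b = 0).card
    with ht
  set N := ((Finset.univ : Finset (K × K)).filter fun pt ↦ Φ.evalEval pt.1 pt.2 = 0).card with hN
  set bad := (Finset.univ : Finset K).filter fun a ↦ ¬ (Φ.map (evalRingHom a)).Separable
    with hbad
  -- the counting facts
  have hNsum : N = ∑ a, t a := card_filter_evalEval_eq_sum Φ
  have hN₁sum : S.card = p + ∑ a, r a := card_ratPlaces_eq_card_poles_add_sum x
  have hple : p ≤ d := by
    have := card_filter_not_mem_le (K := K) (F := F) hxt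
    rwa [hfinx] at this
  have hrle : ∀ a, r a ≤ d := fun a ↦ by
    have := card_filter_valuation_sub_lt_one_le (K := K) (F := F) hxt a
    rwa [hfinx] at this
  have htle : ∀ a, t a ≤ d := fun a ↦ card_filter_evalEval_le hm a
  have hgood : ∀ a, a ∉ bad → r a = t a := fun a ha ↦ by
    have hsepa : (Φ.map (evalRingHom a)).Separable := by
      simpa [hbad] using ha
    exact card_filter_valuation_sub_lt_one_eq (K := K) (F := F) hm hmin hfin a hsepa
  have hbadle : bad.card ≤ d * (d - 1) := card_filter_not_separable_le hm hdeg hsep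
  -- `|N - N₁| ≤ d + d · #bad`
  have hsumt : ∑ a, t a = ∑ a ∈ Finset.univ.filter (fun a ↦ a ∉ bad), t a + ∑ a ∈ bad, t a := by
    rw [← Finset.sum_filter_add_sum_filter_not Finset.univ (fun a ↦ a ∉ bad)]
    congr 1
    apply Finset.sum_congr _ (fun _ _ ↦ rfl)
    ext a; simp
  have hsumr : ∑ a, r a = ∑ a ∈ Finset.univ.filter (fun a ↦ a ∉ bad), r a + ∑ a ∈ bad, r a := by
    rw [← Finset.sum_filter_add_sum_filter_not Finset.univ (fun a ↦ a ∉ bad)]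
    congr 1
    apply Finset.sum_congr _ (fun _ _ ↦ rfl)
    ext a; simp
  have hgoodsum : ∑ a ∈ Finset.univ.filter (fun a ↦ a ∉ bad), r a =
      ∑ a ∈ Finset.univ.filter (fun a ↦ a ∉ bad), t a :=
    Finset.sum_congr rfl fun a ha ↦ hgood a (Finset.mem_filter.1 ha).2
  have hbadt : ∑ a ∈ bad, t a ≤ bad.card * d := by
    have := Finset.sum_le_card_nsmul bad t d fun a _ ↦ htle a
    simpa using this
  have hbadr : ∑ a ∈ bad, r a ≤ bad.card * d := by
    have := Finset.sum_le_card_nsmul bad r d fun a _ ↦ hrle a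
    simpa using this
  have h1 : bad.card * d ≤ d * (d * (d - 1)) := by
    rw [mul_comm]; exact Nat.mul_le_mul_left d hbadle
  constructor
  · rw [hNsum, hsumt, hN₁sum, hsumr, hgoodsum]
    omega
  · rw [hNsum, hsumt, hN₁sum, hsumr, hgoodsum]
    omega

end Model

/-! ### Weil's estimate for the number of points of a plane model -/

section Count

variable {K : Type u} [Field K]

/-- **No rational places unless `K` is the full constant field.** If `K` is not integrally closed in
the function field `F/K`, then `F/K` has no place of degree one: an element `z ∉ K` algebraic over
`K` lies in every valuation ring, and at a rational place it would be congruent to a constant `c`,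
but `z - c ≠ 0` is algebraic over `K`, hence a unit of `O_P`. (Stichtenoth Cor. 1.1.16 / Lemma
3.6.4 phrased for places of degree one.) [folklore] -/
theorem degree_ne_one_of_not_isIntegrallyClosedIn {F : Type v} [Field F] [Algebra K F]
    [IsAlgFunctionField K F] (h : ¬ IsIntegrallyClosedIn K F) (P : PlaceOver K F) :
    P.degree ≠ 1 := by
  intro hP
  apply h
  refine isIntegrallyClosedIn_iff.2 ⟨(algebraMap K F).injective, fun {z} hz ↦ ?_⟩
  have halg : IsAlgebraic K z := hz.isAlgebraic
  have hzO : z ∈ P.toValuationSubring :=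
    IsAlgFunctionField.mem_valuationSubring_of_isAlgebraic P.toValuationSubring P.algebraMap_mem halg
  obtain ⟨c, hc⟩ := P.exists_valuation_sub_algebraMap_lt_one_of_degree_eq_one hP hzO
  refine ⟨c, ?_⟩
  by_contra hne
  have hw0 : z - algebraMap K F c ≠ 0 := sub_ne_zero.2 (Ne.symm hne)
  have hwalg : IsAlgebraic K (z - algebraMap K F c)⁻¹ :=
    (halg.sub (isAlgebraic_algebraMap c)).inv
  have hinv : (z - algebraMap K F c)⁻¹ ∈ P.toValuationSubring :=
    IsAlgFunctionField.mem_valuationSubring_of_isAlgebraic P.toValuationSubring P.algebraMap_mem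
      hwalg
  have h1 : P.valuation (z - algebraMap K F c)⁻¹ ≤ 1 :=
    (P.toValuationSubring.valuation_le_one_iff _).2 hinv
  have h2 : 1 < P.valuation (z - algebraMap K F c)⁻¹ := by
    rw [Valuation.one_lt_val_iff _ (inv_ne_zero hw0), inv_inv]
    exact hc
  exact not_lt.2 h1 h2

variable [Fintype K]

omit [Fintype K] in
/-- **Separability of `K(X)[Y]/(Φ)` over `K(X)`** for `Φ` irreducible over `K(X)` and separable.
[folklore] -/
theorem isSeparable_adjoinRoot_of_separable {ΦL : (RatFunc K)[X]} [Fact (Irreducible ΦL)]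
    (hmL : ΦL.Monic) (hsep : ΦL.Separable) :
    Algebra.IsSeparable (RatFunc K) (AdjoinRoot ΦL) := by
  set pb := AdjoinRoot.powerBasis (Fact.out : Irreducible ΦL).ne_zero with hpb
  have hmin : minpoly (RatFunc K) pb.gen = ΦL := AdjoinRoot.minpoly_powerBasis_gen_of_monic hmL
  have h1 : IsSeparable (RatFunc K) pb.gen := by
    rw [IsSeparable, hmin]; exact hsep
  have h2 : Algebra.IsSeparable (RatFunc K) (RatFunc K)⟮pb.gen⟯ :=
    (IntermediateField.isSeparable_adjoin_simple_iff_isSeparable (RatFunc K)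
      (AdjoinRoot ΦL)).2 h1
  have h3 : (RatFunc K)⟮pb.gen⟯ = ⊤ := by
    apply IntermediateField.toSubalgebra_injective
    rw [IntermediateField.adjoin_simple_toSubalgebra_of_isAlgebraic pb.isIntegral_gen.isAlgebraic,
      pb.adjoin_gen_eq_top, IntermediateField.top_toSubalgebra]
  rw [h3] at h2
  exact AlgEquiv.Algebra.isSeparable (IntermediateField.topEquiv (F := RatFunc K)
    (E := AdjoinRoot ΦL))

/-- **Weil's estimate for the number of rational points of a singular plane curve (two-sided;
Cafure–Matera 2006, eq. (1.2) and Lemma 5.1, up to the lower-order term).** Let `K = 𝔽_q` and let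
`Φ ∈ K[X][Y]` be monic of degree `d` in `Y` with `deg_X (coeff of Yⁱ) + i ≤ d` for `i < d`
(total degree `d`), separable over `K(X)`, whose image in `K̄[X][Y]` is irreducible for some
embedding `σ` of `K` into an algebraically closed field. Then the number
`N = #{(a, b) ∈ K² : Φ(a, b) = 0}` of rational points satisfies
`|N - (q + 1)| ≤ (d-1)(d-2)√q + d(1 + d(d-1))`.
Proof: `|N₁ - (q+1)| ≤ 2g√q ≤ (d-1)(d-2)√q` for the number `N₁` of rational places of the function
field `K(X)[Y]/(Φ)` (Hasse–Weil, genus bound for plane models), and `|N - N₁| ≤ d(1 + d(d-1))`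
(`card_zeros_le_card_ratPlaces_add`). [cite: CafureMatera2006, Lemma 5.1]
[cite: Stichtenoth2009, Thm. 3.3.7 and Thm. 5.2.3] -/
theorem abs_card_zeros_sub_le {Φ : K[X][Y]} (hm : Φ.Monic)
    (hdeg : ∀ i, i < Φ.natDegree → (Φ.coeff i).natDegree + i ≤ Φ.natDegree)
    {Kbar : Type*} [Field Kbar] [IsAlgClosed Kbar] (σ : K →+* Kbar)
    (hirr : Irreducible (Φ.map (mapRingHom σ)))
    (hsep : (Φ.map (algebraMap K[X] (RatFunc K))).Separable) :
    |((Finset.univ.filter fun p : K × K ↦ Φ.evalEval p.1 p.2 = 0).card : ℝ) -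
        ((Fintype.card K : ℝ) + 1)| ≤
      ((Φ.natDegree - 1) * (Φ.natDegree - 2) : ℕ) * √(Fintype.card K : ℝ) +
        (Φ.natDegree * (1 + Φ.natDegree * (Φ.natDegree - 1)) : ℕ) := by
  -- the function field `F = K(X)[Y]/(Φ)`
  set ΦL : (RatFunc K)[X] := Φ.map (algebraMap K[X] (RatFunc K)) with hΦL
  have hmL : ΦL.Monic := hm.map _
  have hirrL : Irreducible ΦL :=
    irreducible_map_ratFunc hm (irreducible_of_irreducible_map σ hm hirr)
  haveI : Fact (Irreducible ΦL) := ⟨hirrL⟩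
  set pb := AdjoinRoot.powerBasis hirrL.ne_zero with hpb
  have hgen : pb.gen = AdjoinRoot.root ΦL := AdjoinRoot.powerBasis_gen _
  have hmin : minpoly (RatFunc K) pb.gen = ΦL := AdjoinRoot.minpoly_powerBasis_gen_of_monic hmL
  have hdim : pb.dim = Φ.natDegree := by
    rw [← pb.natDegree_minpoly, hmin, hm.natDegree_map]
  haveI : IsAlgFunctionField K (AdjoinRoot ΦL) := isAlgFunctionField_of_powerBasis pb
  haveI : IsIntegrallyClosedIn K (AdjoinRoot ΦL) :=
    isIntegrallyClosedIn_of_irreducible_map pb hm hmin σ hirr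
  haveI : FiniteDimensional (RatFunc K) (AdjoinRoot ΦL) := pb.finite
  haveI : Algebra.IsSeparable (RatFunc K) (AdjoinRoot ΦL) :=
    isSeparable_adjoinRoot_of_separable hmL hsep
  have hfin : Module.finrank (RatFunc K) (AdjoinRoot ΦL) = Φ.natDegree := by
    rw [pb.finrank, hdim]
  -- `x`, `y`, genus bound
  set x : AdjoinRoot ΦL := algebraMap K[X] (AdjoinRoot ΦL) X with hx
  have hxt : Transcendental K x := transcendental_algebraMap_X K (AdjoinRoot ΦL)
  have hy : pb.gen ∈ riemannRochSpace (principalDivisor K x)⁻ := by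
    have hΦy : aeval pb.gen ΦL = 0 := by
      rw [hgen, AdjoinRoot.aeval_eq, AdjoinRoot.mk_self]
    exact mem_riemannRochSpace_negPart_of_aeval_eq_zero' hΦy hm hdeg
  have hfinx : Module.finrank K⟮x⟯ (AdjoinRoot ΦL) = Φ.natDegree := by
    rw [finrank_adjoin_algebraMap_X_eq_dim pb, hdim]
  have hgenus : 2 * genus K (AdjoinRoot ΦL) ≤ (Φ.natDegree - 1) * (Φ.natDegree - 2) :=
    two_mul_genus_le_of_planeModel hxt hfinx hy (hdim ▸ linearIndependent_monomial pb)
  -- the comparison of points and places, and Hasse–Weil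
  obtain ⟨hup, hlow⟩ := card_zeros_le_card_ratPlaces_add (K := K) (F := AdjoinRoot ΦL) hm hdeg
    hmin hfin hsep
  set d := Φ.natDegree with hd
  set q := Fintype.card K with hq
  have hHW := card_toFinset_degree_eq_one_mem_Icc (K := K) (F := AdjoinRoot ΦL)
  rw [Set.mem_Icc, ← hq] at hHW
  have hg : (2 * genus K (AdjoinRoot ΦL) : ℝ) ≤ ((d - 1) * (d - 2) : ℕ) := by
    exact_mod_cast hgenus
  have hs : 0 ≤ √(q : ℝ) := Real.sqrt_nonneg _
  have hgs := mul_le_mul_of_nonneg_right hg hs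
  have hup' : ((Finset.univ.filter fun p : K × K ↦ Φ.evalEval p.1 p.2 = 0).card : ℝ) ≤
      (finite_setOf_degree_eq (K := K) (F := AdjoinRoot ΦL) 1).toFinset.card +
        (d * (d * (d - 1)) : ℕ) := by exact_mod_cast hup
  have hlow' : ((finite_setOf_degree_eq (K := K) (F := AdjoinRoot ΦL) 1).toFinset.card : ℝ) ≤
      (Finset.univ.filter fun p : K × K ↦ Φ.evalEval p.1 p.2 = 0).card + d +
        (d * (d * (d - 1)) : ℕ) := by exact_mod_cast hlow
  have hcast : ((d * (1 + d * (d - 1)) : ℕ) : ℝ) = d + (d * (d * (d - 1)) : ℕ) := by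
    push_cast; ring
  rw [abs_le, hcast]
  constructor
  · nlinarith [hHW.1, hHW.2]
  · nlinarith [hHW.1, hHW.2]

/-- **Upper Weil bound for an irreducible, not necessarily absolutely irreducible, plane curve.**
Let `K = 𝔽_q` and let `Φ ∈ K[X][Y]` be monic of degree `d` in `Y` with
`deg_X (coeff of Yⁱ) + i ≤ d` for `i < d`, irreducible in `K[X][Y]` and separable over `K(X)`. Then
`#{(a, b) ∈ K² : Φ(a, b) = 0} ≤ q + 1 + (d-1)(d-2)√q + d · d(d-1)`.
If `K` is the full constant field of `F = K(X)[Y]/(Φ)` this is the upper half of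
`abs_card_zeros_sub_le`; otherwise `F/K` has no rational places at all
(`degree_ne_one_of_not_isIntegrallyClosedIn`) and only the `≤ d(d-1)` inseparable fibres carry
rational points. (This replaces Cafure–Matera's Lemma 2.3 / the case `ν = 0` of Lemma 5.1 for the
upper bounds of §5.) [cite: CafureMatera2006, Lemma 5.1 and Lemma 2.3]
[cite: Stichtenoth2009, Thm. 3.3.7 and Thm. 5.2.3] -/
theorem card_zeros_le_of_irreducible {Φ : K[X][Y]} (hm : Φ.Monic)
    (hdeg : ∀ i, i < Φ.natDegree → (Φ.coeff i).natDegree + i ≤ Φ.natDegree)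
    (hirr : Irreducible Φ) (hsep : (Φ.map (algebraMap K[X] (RatFunc K))).Separable) :
    ((Finset.univ.filter fun p : K × K ↦ Φ.evalEval p.1 p.2 = 0).card : ℝ) ≤
      (Fintype.card K : ℝ) + 1 +
        ((Φ.natDegree - 1) * (Φ.natDegree - 2) : ℕ) * √(Fintype.card K : ℝ) +
          (Φ.natDegree * (Φ.natDegree * (Φ.natDegree - 1)) : ℕ) := by
  -- the function field `F = K(X)[Y]/(Φ)`
  set ΦL : (RatFunc K)[X] := Φ.map (algebraMap K[X] (RatFunc K)) with hΦL
  have hmL : ΦL.Monic := hm.map _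
  have hirrL : Irreducible ΦL := irreducible_map_ratFunc hm hirr
  haveI : Fact (Irreducible ΦL) := ⟨hirrL⟩
  set pb := AdjoinRoot.powerBasis hirrL.ne_zero with hpb
  have hgen : pb.gen = AdjoinRoot.root ΦL := AdjoinRoot.powerBasis_gen _
  have hmin : minpoly (RatFunc K) pb.gen = ΦL := AdjoinRoot.minpoly_powerBasis_gen_of_monic hmL
  have hdim : pb.dim = Φ.natDegree := by
    rw [← pb.natDegree_minpoly, hmin, hm.natDegree_map]
  haveI : IsAlgFunctionField K (AdjoinRoot ΦL) := isAlgFunctionField_of_powerBasis pb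
  haveI : FiniteDimensional (RatFunc K) (AdjoinRoot ΦL) := pb.finite
  haveI : Algebra.IsSeparable (RatFunc K) (AdjoinRoot ΦL) :=
    isSeparable_adjoinRoot_of_separable hmL hsep
  have hfin : Module.finrank (RatFunc K) (AdjoinRoot ΦL) = Φ.natDegree := by
    rw [pb.finrank, hdim]
  obtain ⟨hup, -⟩ := card_zeros_le_card_ratPlaces_add (K := K) (F := AdjoinRoot ΦL) hm hdeg
    hmin hfin hsep
  have hup' : ((Finset.univ.filter fun p : K × K ↦ Φ.evalEval p.1 p.2 = 0).card : ℝ) ≤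
      (finite_setOf_degree_eq (K := K) (F := AdjoinRoot ΦL) 1).toFinset.card +
        (Φ.natDegree * (Φ.natDegree * (Φ.natDegree - 1)) : ℕ) := by exact_mod_cast hup
  have hs : 0 ≤ √(Fintype.card K : ℝ) := Real.sqrt_nonneg _
  have hnn : (0 : ℝ) ≤ ((Φ.natDegree - 1) * (Φ.natDegree - 2) : ℕ) * √(Fintype.card K : ℝ) :=
    mul_nonneg (Nat.cast_nonneg _) hs
  by_cases hic : IsIntegrallyClosedIn K (AdjoinRoot ΦL)
  · -- full constant field `K`: Hasse–Weil and the genus bound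
    set x : AdjoinRoot ΦL := algebraMap K[X] (AdjoinRoot ΦL) X with hx
    have hxt : Transcendental K x := transcendental_algebraMap_X K (AdjoinRoot ΦL)
    have hy : pb.gen ∈ riemannRochSpace (principalDivisor K x)⁻ := by
      have hΦy : aeval pb.gen ΦL = 0 := by
        rw [hgen, AdjoinRoot.aeval_eq, AdjoinRoot.mk_self]
      exact mem_riemannRochSpace_negPart_of_aeval_eq_zero' hΦy hm hdeg
    have hfinx : Module.finrank K⟮x⟯ (AdjoinRoot ΦL) = Φ.natDegree := by
      rw [finrank_adjoin_algebraMap_X_eq_dim pb, hdim]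
    have hgenus : 2 * genus K (AdjoinRoot ΦL) ≤ (Φ.natDegree - 1) * (Φ.natDegree - 2) :=
      two_mul_genus_le_of_planeModel hxt hfinx hy (hdim ▸ linearIndependent_monomial pb)
    have hHW := card_toFinset_degree_eq_one_mem_Icc (K := K) (F := AdjoinRoot ΦL)
    rw [Set.mem_Icc] at hHW
    have hg : (2 * genus K (AdjoinRoot ΦL) : ℝ) ≤ ((Φ.natDegree - 1) * (Φ.natDegree - 2) : ℕ) := by
      exact_mod_cast hgenus
    have hgs := mul_le_mul_of_nonneg_right hg hs
    nlinarith [hHW.2]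
  · -- no rational places at all
    have hempty : (finite_setOf_degree_eq (K := K) (F := AdjoinRoot ΦL) 1).toFinset = ∅ := by
      ext P
      simp only [Set.Finite.mem_toFinset, Set.mem_setOf_eq, Finset.notMem_empty, iff_false]
      exact degree_ne_one_of_not_isIntegrallyClosedIn hic P
    rw [hempty, Finset.card_empty, Nat.cast_zero, zero_add] at hup'
    have hq0 : (0 : ℝ) ≤ Fintype.card K := Nat.cast_nonneg _
    linarith

end Count

end Literature.NumberTheory.DiophantineGeometry.AlgFunctionField
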